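import Summits.QuantumFields.GaugeBoot.LoopEquationTwoWords
import HarnessLib

/-!
# The one-link Schwinger–Dyson identity with ANY NUMBER OF SPECTATOR LOOPS: pair form and polarisation (gauge-boot, Lean layer, ADDENDUM 25 part A, file 1/2)

HONEST FRAMING (cell `pub-gaugeboot`, page 1 of every file): the venture produces certified bounds
on lattice expectations at stated coupling, gauge group, dimension and torus size; NOT a mass gap,
NOT a continuum limit, NOT a string tension; NOT Yang–Mills-summit-bearing (barriers
`FixedCouplingUltralocality`, `PerturbativeInvisibility`).  This file enters no number: it is the
exact Schwinger–Dyson identity behind ALL multi-trace rows of the finite-`N` bootstrap.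

## Content

`LoopEquationSpectatorPair.lean` / `LoopEquationTwoWords.lean` carry ONE spectator loop, `LoopEquationMultiplier.lean`
a multiplier that does not read the marked link.  Here the test function is
`tr(Y ρ(hol_{x₀} w)) · Π_{a ∈ ι} tr ρ(hol_{x_a} v_a) · g` for a finite family of spectator words `(v_a)` — which MAY read
the marked link `e = (x, μ)`, in either orientation, any number of times — and a continuous multiplier `g` ignoring
`e`.  By the product rule (`HasDerivAt.fun_finsetProd`) in the tree's one-link Schwinger–Dyson identity:

* `sum_trace_mul_sum_prod_insDeriv_unitDir` — contracting the spectator derivative over the matrix units gives, for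
  each spectator `v_a`, its MERGE TERMS (`mergeTerm`, `LoopEquationSpectatorPair`) times the product of the other
  spectator traces;
* `sd_pairMany` — the pair form
  `∫ (tr(Y·insDeriv_X hol w)·Π_a tr hol v_a + tr(Y ρ(hol w))·Σ_a (Π_{b≠a} tr hol v_b)·tr(insDeriv_X hol v_a))·g dμ_β
   = β ∫ tr(Y ρ(hol w))·Π_a tr hol v_a·g·(−½ plaqIns_X) dμ_β`;
  the predicate `SDPairMany` and its polarisation (`…_of_parts/_of_traceless/_of_skew`).
The assembled multi-trace loop equation (Kazakov–Zheng's general finite-`N` Makeenko–Migdal equation) and its `SU(N)` /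
`U(N)` instances are in `LoopEquationManyWords.lean`.

References: V. Kazakov, Z. Zheng, arXiv:2404.16925 §2.3 ("the variation of `W[C]_{ab} Π_i W[C_i] e^{−S}`");
P. Anderson, M. Kruczenski, Nucl. Phys. B 921 (2017) §2; S. Chatterjee, arXiv:1502.07719 §3.  Everything is `[folklore]`
given the tree's Schwinger–Dyson identity.
-/

noncomputable section

open MeasureTheory Filter Topology NormedSpace
open scoped Matrix.Norms.Frobenius Matrix
open Literature.MathematicalPhysics.QuantumFieldTheory
open Summit.QuantumFields.YangMills.Cruxes.CurvatureAmnesia.WardDefect.SchwingerDyson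

namespace Summit.QuantumFields.GaugeBoot

variable {d L N : ℕ} {G : Type} [Group G] {ρ : G →* Matrix (Fin N) (Fin N) ℂ}
variable {ι : Type} [Fintype ι] [DecidableEq ι]

/-! ## Contraction of the spectator derivative -/

section Pointwise

/-- **Merge contraction for a family of spectators**: `Σ_ij tr(E_ji ρ(hol w))·Σ_a (Π_{b≠a} tr hol v_b)·tr(insDeriv_{X_ij} hol v_a)
= Σ_a (Π_{b≠a} tr hol v_b)·Σ_{k'} mergeTerm_{k'}(w, v_a)`. [folklore] -/
theorem sum_trace_mul_sum_prod_insDeriv_unitDir (s : ℂ) (x : Site d L) (μ : Fin d) (U : GaugeConfig d L G) (w : Word d)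
    (xs : ι → Site d L) (vs : ι → Word d) :
    ∑ i : Fin N, ∑ j : Fin N, (Matrix.single j i (1 : ℂ) * ρ (wordHolonomy U x w)).trace *
        ∑ a, (∏ b ∈ Finset.univ.erase a, (ρ (wordHolonomy U (xs b) (vs b))).trace) *
          (insDeriv ρ (x, μ) (unitDir s i j) U (xs a) (vs a)).trace =
      ∑ a, (∏ b ∈ Finset.univ.erase a, (ρ (wordHolonomy U (xs b) (vs b))).trace) *
        ∑ k ∈ Finset.range (vs a).length, mergeTerm ρ s x μ U w (xs a) (vs a) k := by
  calc ∑ i : Fin N, ∑ j : Fin N, (Matrix.single j i (1 : ℂ) * ρ (wordHolonomy U x w)).trace *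
        ∑ a, (∏ b ∈ Finset.univ.erase a, (ρ (wordHolonomy U (xs b) (vs b))).trace) *
          (insDeriv ρ (x, μ) (unitDir s i j) U (xs a) (vs a)).trace
      = ∑ i : Fin N, ∑ j : Fin N, ∑ a, (Matrix.single j i (1 : ℂ) * ρ (wordHolonomy U x w)).trace *
        ((∏ b ∈ Finset.univ.erase a, (ρ (wordHolonomy U (xs b) (vs b))).trace) *
          (insDeriv ρ (x, μ) (unitDir s i j) U (xs a) (vs a)).trace) := by simp only [Finset.mul_sum]
    _ = ∑ i : Fin N, ∑ a, ∑ j : Fin N, (Matrix.single j i (1 : ℂ) * ρ (wordHolonomy U x w)).trace *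
        ((∏ b ∈ Finset.univ.erase a, (ρ (wordHolonomy U (xs b) (vs b))).trace) *
          (insDeriv ρ (x, μ) (unitDir s i j) U (xs a) (vs a)).trace) :=
        Finset.sum_congr rfl fun _ _ => Finset.sum_comm
    _ = ∑ a, ∑ i : Fin N, ∑ j : Fin N, (Matrix.single j i (1 : ℂ) * ρ (wordHolonomy U x w)).trace *
        ((∏ b ∈ Finset.univ.erase a, (ρ (wordHolonomy U (xs b) (vs b))).trace) *
          (insDeriv ρ (x, μ) (unitDir s i j) U (xs a) (vs a)).trace) := Finset.sum_comm
    _ = ∑ a, (∏ b ∈ Finset.univ.erase a, (ρ (wordHolonomy U (xs b) (vs b))).trace) *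
        ∑ i : Fin N, ∑ j : Fin N, (Matrix.single j i (1 : ℂ) * ρ (wordHolonomy U x w)).trace *
          (insDeriv ρ (x, μ) (unitDir s i j) U (xs a) (vs a)).trace := by
        refine Finset.sum_congr rfl fun a _ => ?_
        rw [Finset.mul_sum]
        refine Finset.sum_congr rfl fun i _ => ?_
        rw [Finset.mul_sum]
        exact Finset.sum_congr rfl fun j _ => by ring
    _ = ∑ a, (∏ b ∈ Finset.univ.erase a, (ρ (wordHolonomy U (xs b) (vs b))).trace) *
        ∑ k ∈ Finset.range (vs a).length, mergeTerm ρ s x μ U w (xs a) (vs a) k :=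
        Finset.sum_congr rfl fun a _ => by rw [sum_trace_mul_trace_insDeriv_unitDir s x μ U w (xs a) (vs a)]

omit [Fintype ι] [DecidableEq ι] in
/-- Linearity of the spectator-derivative sum in the direction. [folklore] -/
theorem sum_prod_insDeriv_add_smul (S : Finset ι) (T : ι → Finset ι) (x : Site d L) (μ : Fin d) (U : GaugeConfig d L G)
    (xs : ι → Site d L) (vs : ι → Word d) (A B : Matrix (Fin N) (Fin N) ℂ) (c : ℂ) :
    ∑ a ∈ S, (∏ b ∈ T a, (ρ (wordHolonomy U (xs b) (vs b))).trace) *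
        (insDeriv ρ (x, μ) (A + c • B) U (xs a) (vs a)).trace =
      (∑ a ∈ S, (∏ b ∈ T a, (ρ (wordHolonomy U (xs b) (vs b))).trace) * (insDeriv ρ (x, μ) A U (xs a) (vs a)).trace) +
        c * ∑ a ∈ S, (∏ b ∈ T a, (ρ (wordHolonomy U (xs b) (vs b))).trace) *
          (insDeriv ρ (x, μ) B U (xs a) (vs a)).trace := by
  rw [Finset.mul_sum, ← Finset.sum_add_distrib]
  refine Finset.sum_congr rfl fun a _ => ?_
  rw [insDeriv_add, insDeriv_smul, Matrix.trace_add, Matrix.trace_smul, smul_eq_mul]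
  ring

end Pointwise

/-! ## The Schwinger–Dyson identity with a family of spectators (pair form) and its polarisation -/

section SDPairMany

variable [TopologicalSpace G] [IsTopologicalGroup G] [CompactSpace G] [MeasurableSpace G] [BorelSpace G]
  (r : LatticeRep G)

/-- **The one-link Schwinger–Dyson identity for a word with a finite family of spectator loops and a multiplier
(pair form).**  For an admissible direction `X` (skew-Hermitian, `r.ρ(k t) = exp(tX)` along a one-parameter subgroup `k`),
ANY matrix `Y`, a word `w` from `x₀`, spectator words `v_a` from `x_a` (`a ∈ ι` finite), the edge `e = (x, μ)`, and a
continuous `g` with `g(U[e ↦ h]) = g(U)` (product rule in the tree's identity):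
`∫ (tr(Y·insDeriv_X hol w)·Π_a tr hol v_a + tr(Y ρ(hol w))·Σ_a (Π_{b≠a} tr hol v_b)·tr(insDeriv_X hol v_a))·g dμ_β
 = β ∫ tr(Y ρ(hol w))·Π_a tr hol v_a·g·(−½ plaqIns_X) dμ_β`. [folklore] -/
theorem sd_pairMany [NeZero L] (β : ℝ) (x : Site d L) (μ : Fin d) {k : ℝ → G} (hk : ∀ s t, k (s + t) = k s * k t)
    {X : Matrix (Fin r.N) (Fin r.N) ℂ} (hX : ∀ t, r.ρ (k t) = exp ((t : ℂ) • X)) (hXs : Xᴴ = -X)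
    (Y : Matrix (Fin r.N) (Fin r.N) ℂ) (x₀ : Site d L) (w : Word d) (xs : ι → Site d L) (vs : ι → Word d)
    {g : GaugeConfig d L G → ℂ} (hg : Continuous g)
    (hge : ∀ (U : GaugeConfig d L G) (h : G), g (Function.update U (x, μ) h) = g U) :
    ∫ U, ((Y * insDeriv r.ρ (x, μ) X U x₀ w).trace * (∏ a, (r.ρ (wordHolonomy U (xs a) (vs a))).trace) +
        (Y * r.ρ (wordHolonomy U x₀ w)).trace *
          ∑ a, (∏ b ∈ Finset.univ.erase a, (r.ρ (wordHolonomy U (xs b) (vs b))).trace) *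
            (insDeriv r.ρ (x, μ) X U (xs a) (vs a)).trace) * g U
        ∂(wilsonMeasure (d := d) (L := L) r.ρ β) =
      (β : ℂ) * ∫ U, (Y * r.ρ (wordHolonomy U x₀ w)).trace * (∏ a, (r.ρ (wordHolonomy U (xs a) (vs a))).trace) * g U *
        (-(1 / 2) * plaqIns r.ρ X U x μ) ∂(wilsonMeasure (d := d) (L := L) r.ρ β) := by
  have hcprod : Continuous fun U : GaugeConfig d L G => ∏ a, (r.ρ (wordHolonomy U (xs a) (vs a))).trace :=
    continuous_finsetProd _ fun a _ => continuous_trace_wordHolonomy r (xs a) (vs a)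
  have hcsum : Continuous fun U : GaugeConfig d L G =>
      ∑ a, (∏ b ∈ Finset.univ.erase a, (r.ρ (wordHolonomy U (xs b) (vs b))).trace) *
        (insDeriv r.ρ (x, μ) X U (xs a) (vs a)).trace :=
    continuous_finsetSum _ fun a _ =>
      (continuous_finsetProd _ fun b _ => continuous_trace_wordHolonomy r (xs b) (vs b)).mul
        (continuous_insDeriv (e := (x, μ)) (X := X) r.continuous (xs a) (vs a)).matrix_trace
  have h := integral_shiftDeriv_eq_wilson_complex r β (x, μ) hk
    (fun U => (Y * r.ρ (wordHolonomy U x₀ w)).trace * (∏ a, (r.ρ (wordHolonomy U (xs a) (vs a))).trace) * g U)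
    (fun U => ((Y * insDeriv r.ρ (x, μ) X U x₀ w).trace * (∏ a, (r.ρ (wordHolonomy U (xs a) (vs a))).trace) +
        (Y * r.ρ (wordHolonomy U x₀ w)).trace *
          ∑ a, (∏ b ∈ Finset.univ.erase a, (r.ρ (wordHolonomy U (xs b) (vs b))).trace) *
            (insDeriv r.ρ (x, μ) X U (xs a) (vs a)).trace) * g U)
    ((((continuous_const.mul (r.continuous.comp (continuous_wordHolonomy x₀ w))).matrix_trace).mul hcprod).mul hg)
    (((((continuous_const.mul (continuous_insDeriv (e := (x, μ)) (X := X) r.continuous x₀ w)).matrix_trace).mul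
      hcprod).add (((continuous_const.mul (r.continuous.comp (continuous_wordHolonomy x₀ w))).matrix_trace).mul hcsum)).mul
      hg)
    (fun U => by
      have h1 : HasDerivAt (fun t : ℝ => (Y * r.ρ (wordHolonomy (Function.update U (x, μ) (k t * U (x, μ))) x₀ w)).trace)
          ((Y * insDeriv r.ρ (x, μ) X U x₀ w).trace) 0 := by
        have hd := (traceMulLeftCLM Y).hasFDerivAt.comp_hasDerivAt (0 : ℝ)
          (hasDerivAt_wordHolonomy (e := (x, μ)) hk hX U x₀ w)
        simpa [Function.comp_def] using hd.congr_deriv (traceMulLeftCLM_apply Y _)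
      have h2 : ∀ a ∈ (Finset.univ : Finset ι), HasDerivAt
          (fun t : ℝ => (r.ρ (wordHolonomy (Function.update U (x, μ) (k t * U (x, μ))) (xs a) (vs a))).trace)
          ((insDeriv r.ρ (x, μ) X U (xs a) (vs a)).trace) 0 := fun a _ => by
        have hd := (traceMulLeftCLM (1 : Matrix (Fin r.N) (Fin r.N) ℂ)).hasFDerivAt.comp_hasDerivAt (0 : ℝ)
          (hasDerivAt_wordHolonomy (e := (x, μ)) hk hX U (xs a) (vs a))
        simpa [Function.comp_def, Matrix.one_mul] using hd.congr_deriv (traceMulLeftCLM_apply 1 _)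
      have hprod := HasDerivAt.fun_finsetProd h2
      have h12 := (h1.mul hprod).mul_const (g U)
      simp only [shift_zero hk, smul_eq_mul] at h12
      have hfun : (fun t : ℝ => (Y * r.ρ (wordHolonomy (Function.update U (x, μ) (k t * U (x, μ))) x₀ w)).trace *
            (∏ a, (r.ρ (wordHolonomy (Function.update U (x, μ) (k t * U (x, μ))) (xs a) (vs a))).trace) *
            g (Function.update U (x, μ) (k t * U (x, μ)))) =
          fun t : ℝ => (Y * r.ρ (wordHolonomy (Function.update U (x, μ) (k t * U (x, μ))) x₀ w)).trace *
            (∏ a, (r.ρ (wordHolonomy (Function.update U (x, μ) (k t * U (x, μ))) (xs a) (vs a))).trace) * g U :=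
        funext fun t => by rw [hge]
      rw [hfun]
      exact h12)
    (actionDeriv r.ρ (x, μ) X) (continuous_actionDeriv (e := (x, μ)) (X := X) r.continuous)
    (fun U => hasDerivAt_wilsonAction (e := (x, μ)) hk hX U)
  rw [h]
  congr 1
  refine integral_congr_ae (ae_of_all _ fun U => ?_)
  simp only [actionDeriv_eq_plaqIns hXs r.mem_unitary U x μ]

/-- THE MANY-SPECTATOR PAIR IDENTITY for the direction `X` (marked word `w` from `x₀`, spectators `(x_a, v_a)`, multiplier
`g`, edge `(x, μ)`, coupling `β`), as a predicate in `X` (used to organise polarisation — not a named fact). [folklore] -/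
def SDPairMany [NeZero L] (β : ℝ) (x : Site d L) (μ : Fin d) (x₀ : Site d L) (w : Word d) (xs : ι → Site d L)
    (vs : ι → Word d) (g : GaugeConfig d L G → ℂ) (X : Matrix (Fin r.N) (Fin r.N) ℂ) : Prop :=
  ∀ Y : Matrix (Fin r.N) (Fin r.N) ℂ,
    ∫ U, ((Y * insDeriv r.ρ (x, μ) X U x₀ w).trace * (∏ a, (r.ρ (wordHolonomy U (xs a) (vs a))).trace) +
        (Y * r.ρ (wordHolonomy U x₀ w)).trace *
          ∑ a, (∏ b ∈ Finset.univ.erase a, (r.ρ (wordHolonomy U (xs b) (vs b))).trace) *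
            (insDeriv r.ρ (x, μ) X U (xs a) (vs a)).trace) * g U
        ∂(wilsonMeasure (d := d) (L := L) r.ρ β) =
      (β : ℂ) * ∫ U, (Y * r.ρ (wordHolonomy U x₀ w)).trace * (∏ a, (r.ρ (wordHolonomy U (xs a) (vs a))).trace) * g U *
        (-(1 / 2) * plaqIns r.ρ X U x μ) ∂(wilsonMeasure (d := d) (L := L) r.ρ β)

/-- `sd_pairMany` restated: admissible skew-Hermitian directions satisfy the many-spectator pair identity. [folklore] -/
theorem sdPairMany_of_oneParam [NeZero L] (β : ℝ) (x : Site d L) (μ : Fin d) (x₀ : Site d L) (w : Word d)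
    (xs : ι → Site d L) (vs : ι → Word d) {g : GaugeConfig d L G → ℂ} (hg : Continuous g)
    (hge : ∀ (U : GaugeConfig d L G) (h : G), g (Function.update U (x, μ) h) = g U)
    {X : Matrix (Fin r.N) (Fin r.N) ℂ} (hXs : Xᴴ = -X) {k : ℝ → G}
    (hk : ∀ s t, k (s + t) = k s * k t) (hX : ∀ t, r.ρ (k t) = exp ((t : ℂ) • X)) :
    SDPairMany r β x μ x₀ w xs vs g X :=
  fun Y => sd_pairMany r β x μ hk hX hXs Y x₀ w xs vs hg hge

omit [CompactSpace G] [MeasurableSpace G] [BorelSpace G] in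
/-- Continuity of the left integrand of the many-spectator identity. [folklore] -/
theorem continuous_lhsMany (Y X : Matrix (Fin r.N) (Fin r.N) ℂ) (x : Site d L) (μ : Fin d) (x₀ : Site d L) (w : Word d)
    (xs : ι → Site d L) (vs : ι → Word d) {g : GaugeConfig d L G → ℂ} (hg : Continuous g) :
    Continuous fun U : GaugeConfig d L G =>
      ((Y * insDeriv r.ρ (x, μ) X U x₀ w).trace * (∏ a, (r.ρ (wordHolonomy U (xs a) (vs a))).trace) +
        (Y * r.ρ (wordHolonomy U x₀ w)).trace *
          ∑ a, (∏ b ∈ Finset.univ.erase a, (r.ρ (wordHolonomy U (xs b) (vs b))).trace) *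
            (insDeriv r.ρ (x, μ) X U (xs a) (vs a)).trace) * g U := by
  have h1 : Continuous fun U : GaugeConfig d L G => (Y * insDeriv r.ρ (x, μ) X U x₀ w).trace :=
    (continuous_const.mul (continuous_insDeriv (e := (x, μ)) (X := X) r.continuous x₀ w)).matrix_trace
  have h2 : Continuous fun U : GaugeConfig d L G => ∏ a, (r.ρ (wordHolonomy U (xs a) (vs a))).trace :=
    continuous_finsetProd _ fun a _ => continuous_trace_wordHolonomy r (xs a) (vs a)
  have h3 : Continuous fun U : GaugeConfig d L G => (Y * r.ρ (wordHolonomy U x₀ w)).trace :=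
    (continuous_const.mul (r.continuous.comp (continuous_wordHolonomy x₀ w))).matrix_trace
  have h4 : Continuous fun U : GaugeConfig d L G =>
      ∑ a, (∏ b ∈ Finset.univ.erase a, (r.ρ (wordHolonomy U (xs b) (vs b))).trace) *
        (insDeriv r.ρ (x, μ) X U (xs a) (vs a)).trace :=
    continuous_finsetSum _ fun a _ =>
      (continuous_finsetProd _ fun b _ => continuous_trace_wordHolonomy r (xs b) (vs b)).mul
        (continuous_insDeriv (e := (x, μ)) (X := X) r.continuous (xs a) (vs a)).matrix_trace
  exact ((h1.mul h2).add (h3.mul h4)).mul hg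

omit [DecidableEq ι] [CompactSpace G] [MeasurableSpace G] [BorelSpace G] in
/-- Continuity of the right integrand of the many-spectator identity. [folklore] -/
theorem continuous_rhsMany (Y X : Matrix (Fin r.N) (Fin r.N) ℂ) (x : Site d L) (μ : Fin d) (x₀ : Site d L) (w : Word d)
    (xs : ι → Site d L) (vs : ι → Word d) {g : GaugeConfig d L G → ℂ} (hg : Continuous g) :
    Continuous fun U : GaugeConfig d L G =>
      (Y * r.ρ (wordHolonomy U x₀ w)).trace * (∏ a, (r.ρ (wordHolonomy U (xs a) (vs a))).trace) * g U *
        (-(1 / 2) * plaqIns r.ρ X U x μ) :=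
  ((((continuous_const.mul (r.continuous.comp (continuous_wordHolonomy x₀ w))).matrix_trace).mul
    (continuous_finsetProd _ fun a _ => continuous_trace_wordHolonomy r (xs a) (vs a))).mul hg).mul
    (continuous_const.mul (continuous_plaqIns r X x μ))

/-- **Polarisation step** for the many-spectator identity (both sides are `ℂ`-linear in `X`). [folklore] -/
theorem sdPairMany_of_parts [NeZero L] (β : ℝ) (x : Site d L) (μ : Fin d) (x₀ : Site d L) (w : Word d)
    (xs : ι → Site d L) (vs : ι → Word d) {g : GaugeConfig d L G → ℂ} (hg : Continuous g)
    (X : Matrix (Fin r.N) (Fin r.N) ℂ) (hPA : SDPairMany r β x μ x₀ w xs vs g ((1 / 2 : ℂ) • (X - Xᴴ)))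
    (hPB : SDPairMany r β x μ x₀ w xs vs g ((Complex.I / 2) • (X + Xᴴ))) : SDPairMany r β x μ x₀ w xs vs g X := by
  set A : Matrix (Fin r.N) (Fin r.N) ℂ := (1 / 2 : ℂ) • (X - Xᴴ) with hA
  set B : Matrix (Fin r.N) (Fin r.N) ℂ := (Complex.I / 2) • (X + Xᴴ) with hB
  have hXAB : X = A + (-Complex.I) • B := eq_skewPart_add X
  clear_value A B
  intro Y
  have hiA := integrable_of_continuous r β (continuous_lhsMany r Y A x μ x₀ w xs vs hg)
  have hiB := integrable_of_continuous r β (continuous_lhsMany r Y B x μ x₀ w xs vs hg)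
  have hjA := integrable_of_continuous r β (continuous_rhsMany r Y A x μ x₀ w xs vs hg)
  have hjB := integrable_of_continuous r β (continuous_rhsMany r Y B x μ x₀ w xs vs hg)
  have hl : ∀ U : GaugeConfig d L G,
      ((Y * insDeriv r.ρ (x, μ) X U x₀ w).trace * (∏ a, (r.ρ (wordHolonomy U (xs a) (vs a))).trace) +
          (Y * r.ρ (wordHolonomy U x₀ w)).trace *
            ∑ a, (∏ b ∈ Finset.univ.erase a, (r.ρ (wordHolonomy U (xs b) (vs b))).trace) *
              (insDeriv r.ρ (x, μ) X U (xs a) (vs a)).trace) * g U =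
        ((Y * insDeriv r.ρ (x, μ) A U x₀ w).trace * (∏ a, (r.ρ (wordHolonomy U (xs a) (vs a))).trace) +
            (Y * r.ρ (wordHolonomy U x₀ w)).trace *
              ∑ a, (∏ b ∈ Finset.univ.erase a, (r.ρ (wordHolonomy U (xs b) (vs b))).trace) *
                (insDeriv r.ρ (x, μ) A U (xs a) (vs a)).trace) * g U +
          (-Complex.I) * (((Y * insDeriv r.ρ (x, μ) B U x₀ w).trace * (∏ a, (r.ρ (wordHolonomy U (xs a) (vs a))).trace) +
            (Y * r.ρ (wordHolonomy U x₀ w)).trace *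
              ∑ a, (∏ b ∈ Finset.univ.erase a, (r.ρ (wordHolonomy U (xs b) (vs b))).trace) *
                (insDeriv r.ρ (x, μ) B U (xs a) (vs a)).trace) * g U) := by
    intro U
    rw [hXAB, sum_prod_insDeriv_add_smul, insDeriv_add, insDeriv_smul, Matrix.mul_add, Matrix.mul_smul,
      Matrix.trace_add, Matrix.trace_smul, smul_eq_mul]
    ring
  have hr : ∀ U : GaugeConfig d L G,
      (Y * r.ρ (wordHolonomy U x₀ w)).trace * (∏ a, (r.ρ (wordHolonomy U (xs a) (vs a))).trace) * g U *
          (-(1 / 2) * plaqIns r.ρ X U x μ) =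
        (Y * r.ρ (wordHolonomy U x₀ w)).trace * (∏ a, (r.ρ (wordHolonomy U (xs a) (vs a))).trace) * g U *
            (-(1 / 2) * plaqIns r.ρ A U x μ) +
          (-Complex.I) * ((Y * r.ρ (wordHolonomy U x₀ w)).trace * (∏ a, (r.ρ (wordHolonomy U (xs a) (vs a))).trace) *
            g U * (-(1 / 2) * plaqIns r.ρ B U x μ)) := by
    intro U
    rw [hXAB, plaqIns_add, plaqIns_smul]
    ring
  simp_rw [hl, hr]
  rw [integral_add hiA (hiB.const_mul _), integral_const_mul, integral_add hjA (hjB.const_mul _),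
    integral_const_mul, hPA Y, hPB Y]
  ring

/-- **Polarisation (`𝔰𝔲`-type)** for the many-spectator identity. [folklore] -/
theorem sdPairMany_of_traceless [NeZero L] (β : ℝ) (x : Site d L) (μ : Fin d) (x₀ : Site d L) (w : Word d)
    (xs : ι → Site d L) (vs : ι → Word d) {g : GaugeConfig d L G → ℂ} (hg : Continuous g)
    (hadm : ∀ X : Matrix (Fin r.N) (Fin r.N) ℂ, Xᴴ = -X → X.trace = 0 → SDPairMany r β x μ x₀ w xs vs g X)
    (X : Matrix (Fin r.N) (Fin r.N) ℂ) (hX : X.trace = 0) : SDPairMany r β x μ x₀ w xs vs g X :=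
  sdPairMany_of_parts r β x μ x₀ w xs vs hg X (hadm _ (conjTranspose_skewPart X) (trace_parts_eq_zero hX _).1)
    (hadm _ (conjTranspose_iHermPart X) (trace_parts_eq_zero hX _).2)

/-- **Polarisation (`𝔲`-type)** for the many-spectator identity. [folklore] -/
theorem sdPairMany_of_skew [NeZero L] (β : ℝ) (x : Site d L) (μ : Fin d) (x₀ : Site d L) (w : Word d)
    (xs : ι → Site d L) (vs : ι → Word d) {g : GaugeConfig d L G → ℂ} (hg : Continuous g)
    (hadm : ∀ X : Matrix (Fin r.N) (Fin r.N) ℂ, Xᴴ = -X → SDPairMany r β x μ x₀ w xs vs g X)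
    (X : Matrix (Fin r.N) (Fin r.N) ℂ) : SDPairMany r β x μ x₀ w xs vs g X :=
  sdPairMany_of_parts r β x μ x₀ w xs vs hg X (hadm _ (conjTranspose_skewPart X)) (hadm _ (conjTranspose_iHermPart X))

end SDPairMany

end Summit.QuantumFields.GaugeBoot

end
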